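import Summits.ResolutionOfSingularities.ResolutionOfSingularities.Theorems.EquisingularLiftEquisingularLiftNatSpecimenQuarticPointStep
import Summits.ResolutionOfSingularities.ResolutionOfSingularities.Theorems.EquisingularLiftEquisingularLiftNatSpecimenQuarticTangentLine
import Summits.ResolutionOfSingularities.ResolutionOfSingularities.Theorems.EquisingularLiftEquisingularLiftNatSpecimenQuarticForms
import Literature.AlgebraicGeometry.Motives.HypersurfaceFormsIrreducible
import HarnessLib

/-!
# [OURS · L1 W4.5(b) · EL♮(3)] SPECIMEN-Q DOWNSTAIRS, part C — the AMBIENT point-step charts of the quartic `z² + x⁴ + y⁴`: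
# strict-transform factors, their primality, the reduced exceptional trace `(Xᵢ/1, z/Xᵢ)` and its regular quotient
# (crux `EquisingularLiftNatThree` = stmt-ResolutionOfSingularities-20148, line `sections3`; res-L1-w45b-lead-2 CUT 2026-08-27T08:41:07Z
# «SPECIMEN-Q DOWNSTAIRS» to res-D-pv-034 AS res-L1-s36-pv-3; helper `--supports … --as helper`, closes nothing)

HONEST FRAMING. OURS (cell `res-hironaka`, chain w45b, slot W4.5(b)); NOT a statement of any manuscript; AI-written, weaker
than expert review. Ring-level companion of res-L1-w45b-stub-4's T-ISO-1 layer (p511135 `…SpecimenQuarticPointStep`, p516267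
`…SpecimenQuarticTangentLine`), now for the blow-up of the AMBIENT `𝔸³ = Spec k[x,y,z]` at the origin (charts
`Cᵢ = k[x,y,z][𝔪/Xᵢ] = PointBlowup.Chart 2 k i`, exceptional generator `excᵢ = Xᵢ/1`, fractions `fracᵢⱼ = Xⱼ/Xᵢ`) — the currency
of the (TC) clauses «e ⊄ St(H)», «St(H) ⊄ Z» and «Sing V(Z)_red finite» of the registered stub `stub_elnat_tcDeltaPointResolution`.

CONTENT, `f = z² + x⁴ + y⁴ = X 2² + X 0⁴ + X 1⁴`, `char k ≠ 2`, `k = k̄` where primality is asserted: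
* (C1) `algebraMap f = excᵢ² · f′ᵢ` with `f′₂ = 1 + exc₂²(frac₂₀⁴ + frac₂₁⁴)`, `f′₀ = frac₀₂² + exc₀²(1 + frac₀₁⁴)`,
  `f′₁ = frac₁₂² + exc₁²(frac₁₀⁴ + 1)` (`factor_chart₂/₀/₁`);
* (C4) `(exc₂, f′₂) = (1)` (`span_exc_strict_chart₂_eq_top`);
* (C2) `f′₀`, `f′₁` PRIME and not dividing `exc` (`prime_strict_chart₀/₁`, `not_strict_dvd_exc_chart₀/₁`: through stub-4's
  `exists_ringEquiv_pointChart` they are `Y² + C(X₀²(1 + X₁⁴))`, Eisenstein at `(1, ζ)`, `ζ⁴ = −1`, the tree's `irreducible_X_pow_add_C`);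
* (C3) `√(excᵢ, f′ᵢ) = (excᵢ, fracᵢ₂)` and `Cᵢ/(excᵢ, fracᵢ₂)` REGULAR for `i = 0, 1` (`radical_span_exc_strict_chart₀/₁`,
  `isRegularRing_quotient_exc_frac_chart₀/₁`; `√(X₁, g) = (X₁, X₂)` is stub-4's `radical_span_X_one_g`).

References: The Stacks Project, Tags 0804, 052Q, 0BIQ; Görtz–Wedhorn I (13.19).
-/

set_option linter.dupNamespace false -- mandated namespace `Summit.<Summit>.<Problem>` of this single-conjunct summit

noncomputable section

open MvPolynomial
open Literature.AlgebraicGeometry.Resolution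
open Summit.ResolutionOfSingularities.ResolutionOfSingularities.Theorems.EquisingularLift

namespace Summit.ResolutionOfSingularities.ResolutionOfSingularities.Cruxes.EquisingularLiftNat.Sections

namespace SpecimenQuarticTcDelta

variable (k : Type) [Field k]

/-! ## (C1) The strict-transform factors on the three charts -/

/-- `z`-chart: `f = (z/1)² · (1 + (z/1)²((x/z)⁴ + (y/z)⁴))`. [cite: StacksProject, Tag 052Q] -/
theorem factor_chart₂ :
    algebraMap (MvPolynomial (Fin 3) k) (PointBlowup.Chart 2 k 2) (X 2 ^ 2 + X 0 ^ 4 + X 1 ^ 4) =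
      PointBlowup.exc 2 k 2 ^ 2 * (1 + PointBlowup.exc 2 k 2 ^ 2 * (PointBlowup.frac 2 k 2 0 ^ 4 + PointBlowup.frac 2 k 2 1 ^ 4)) := by
  rw [map_add, map_add, map_pow, map_pow, map_pow, PointBlowup.algebraMap_X 2 k 2 0, PointBlowup.algebraMap_X 2 k 2 1,
    PointBlowup.algebraMap_X 2 k 2 2, PointBlowup.frac_self]
  ring

/-- `x`-chart: `f = (x/1)² · ((z/x)² + (x/1)²(1 + (y/x)⁴))`. [cite: StacksProject, Tag 052Q] -/
theorem factor_chart₀ :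
    algebraMap (MvPolynomial (Fin 3) k) (PointBlowup.Chart 2 k 0) (X 2 ^ 2 + X 0 ^ 4 + X 1 ^ 4) =
      PointBlowup.exc 2 k 0 ^ 2 * (PointBlowup.frac 2 k 0 2 ^ 2 + PointBlowup.exc 2 k 0 ^ 2 * (1 + PointBlowup.frac 2 k 0 1 ^ 4)) := by
  rw [map_add, map_add, map_pow, map_pow, map_pow, PointBlowup.algebraMap_X 2 k 0 0, PointBlowup.algebraMap_X 2 k 0 1,
    PointBlowup.algebraMap_X 2 k 0 2, PointBlowup.frac_self]
  ring

/-- `y`-chart: `f = (y/1)² · ((z/y)² + (y/1)²((x/y)⁴ + 1))`. [cite: StacksProject, Tag 052Q] -/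
theorem factor_chart₁ :
    algebraMap (MvPolynomial (Fin 3) k) (PointBlowup.Chart 2 k 1) (X 2 ^ 2 + X 0 ^ 4 + X 1 ^ 4) =
      PointBlowup.exc 2 k 1 ^ 2 * (PointBlowup.frac 2 k 1 2 ^ 2 + PointBlowup.exc 2 k 1 ^ 2 * (PointBlowup.frac 2 k 1 0 ^ 4 + 1)) := by
  rw [map_add, map_add, map_pow, map_pow, map_pow, PointBlowup.algebraMap_X 2 k 1 0, PointBlowup.algebraMap_X 2 k 1 1,
    PointBlowup.algebraMap_X 2 k 1 2, PointBlowup.frac_self]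
  ring

/-! ## (C4) On the `z`-chart the strict transform misses the exceptional divisor -/

/-- `(z/1, f′₂) = (1)`: `f′₂ ≡ 1 (mod z/1)`. [folklore] -/
theorem span_exc_strict_chart₂_eq_top :
    Ideal.span {PointBlowup.exc 2 k 2,
      1 + PointBlowup.exc 2 k 2 ^ 2 * (PointBlowup.frac 2 k 2 0 ^ 4 + PointBlowup.frac 2 k 2 1 ^ 4)} = ⊤ := by
  rw [Ideal.eq_top_iff_one]
  set e := PointBlowup.exc 2 k 2 with he
  set w := PointBlowup.frac 2 k 2 0 ^ 4 + PointBlowup.frac 2 k 2 1 ^ 4 with hw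
  have hmem : (1 + e ^ 2 * w) - e * (e * w) ∈ Ideal.span ({e, 1 + e ^ 2 * w} : Set (PointBlowup.Chart 2 k 2)) :=
    Ideal.sub_mem _ (Ideal.subset_span (Or.inr rfl)) (Ideal.mul_mem_right _ _ (Ideal.subset_span (Or.inl rfl)))
  have h : (1 + e ^ 2 * w) - e * (e * w) = 1 := by ring
  rwa [h] at hmem

/-! ## (C2)/(C3) The `x`- and `y`-charts through `k[T₀, T₁, T₂] ≅ Cᵢ` -/

/-- The model polynomial `h₀ = T₂² + T₀²(1 + T₁⁴)` of the strict-transform factor on the `x`-chart is PRIME (`k = k̄`, `char k ≠ 2`):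
after `T₀ ↔ T₂` it is `Y² + C(T₂²(1 + T₁⁴))`, Eisenstein at `(T₁, T₂) = (ζ, 1)`, `ζ⁴ = −1`. [folklore] -/
theorem prime_model₀ [IsAlgClosed k] (h2 : (2 : k) ≠ 0) :
    Prime (X 2 ^ 2 + X 0 ^ 2 * (1 + X 1 ^ 4) : MvPolynomial (Fin 3) k) := by
  obtain ⟨ζ, hζ⟩ := IsAlgClosed.exists_pow_nat_eq (-1 : k) (by norm_num : 0 < 4)
  have hζ0 : ζ ≠ 0 := by
    rintro rfl
    norm_num at hζ
  have hfin : finSuccEquiv k 2 (rename (Equiv.swap (0 : Fin 3) 2) (X 2 ^ 2 + X 0 ^ 2 * (1 + X 1 ^ 4) : MvPolynomial (Fin 3) k)) =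
      Polynomial.X ^ 2 + Polynomial.C (X 1 ^ 2 * (1 + X 0 ^ 4)) := by
    have h1 : finSuccEquiv k 2 (X 1) = Polynomial.C (X 0) := finSuccEquiv_X_succ (j := 0)
    have h2' : finSuccEquiv k 2 (X 2) = Polynomial.C (X 1) := finSuccEquiv_X_succ (j := 1)
    simp only [map_add, map_pow, map_mul, map_one, rename_X, Equiv.swap_apply_left, Equiv.swap_apply_right,
      Equiv.swap_apply_of_ne_of_ne (show (1 : Fin 3) ≠ 0 by decide) (show (1 : Fin 3) ≠ 2 by decide),
      finSuccEquiv_X_zero, h1, h2']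
  have hirr : Irreducible (rename (Equiv.swap (0 : Fin 3) 2) (X 2 ^ 2 + X 0 ^ 2 * (1 + X 1 ^ 4) : MvPolynomial (Fin 3) k)) := by
    rw [← MulEquiv.irreducible_iff (finSuccEquiv k 2), hfin]
    refine Literature.AlgebraicGeometry.Motives.SmoothHypersurface.irreducible_X_pow_add_C (by norm_num) _ ![ζ, 1] ?_ 0 ?_
    · simp only [map_add, map_mul, map_pow, map_one, eval_X, Matrix.cons_val_zero, Matrix.cons_val_one, hζ, one_pow]
      ring
    · have hd : (pderiv 0 : Derivation k (MvPolynomial (Fin 2) k) _) (X 1 ^ 2 * (1 + X 0 ^ 4)) = X 1 ^ 2 * (4 * X 0 ^ 3) := by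
        simp [Derivation.leibniz, Derivation.leibniz_pow]
      rw [hd]
      simp only [map_mul, map_pow, eval_X, Matrix.cons_val_zero, Matrix.cons_val_one, map_ofNat, one_pow, one_mul]
      exact mul_ne_zero (SpecimenQuartic.four_ne_zero k h2) (pow_ne_zero 3 hζ0)
  have hirr' : Irreducible (X 2 ^ 2 + X 0 ^ 2 * (1 + X 1 ^ 4) : MvPolynomial (Fin 3) k) :=
    (MulEquiv.irreducible_iff (renameEquiv k (Equiv.swap (0 : Fin 3) 2)).toMulEquiv
      (x := (X 2 ^ 2 + X 0 ^ 2 * (1 + X 1 ^ 4) : MvPolynomial (Fin 3) k))).mp hirr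
  exact UniqueFactorizationMonoid.irreducible_iff_prime.mp hirr'

/-- The model polynomial `h₁ = T₂² + T₁²(T₀⁴ + 1)` of the strict-transform factor on the `y`-chart is PRIME: it is `h₀` with
`T₀ ↔ T₁`. [folklore] -/
theorem prime_model₁ [IsAlgClosed k] (h2 : (2 : k) ≠ 0) :
    Prime (X 2 ^ 2 + X 1 ^ 2 * (X 0 ^ 4 + 1) : MvPolynomial (Fin 3) k) := by
  have h : (X 2 ^ 2 + X 1 ^ 2 * (X 0 ^ 4 + 1) : MvPolynomial (Fin 3) k) =
      rename (Equiv.swap (0 : Fin 3) 1) (X 2 ^ 2 + X 0 ^ 2 * (1 + X 1 ^ 4)) := by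
    simp only [map_add, map_pow, map_mul, map_one, rename_X, Equiv.swap_apply_left, Equiv.swap_apply_right,
      Equiv.swap_apply_of_ne_of_ne (show (2 : Fin 3) ≠ 0 by decide) (show (2 : Fin 3) ≠ 1 by decide)]
    ring
  rw [h]
  exact (MulEquiv.prime_iff (renameEquiv k (Equiv.swap (0 : Fin 3) 1)).toMulEquiv).mpr (prime_model₀ k h2)

/-- `h₀ ∤ T₀` in `k[T]` (a monic quadratic in `T₂` cannot divide a `T₂`-constant). [folklore] -/
theorem not_model₀_dvd_X_zero : ¬ ((X 2 ^ 2 + X 0 ^ 2 * (1 + X 1 ^ 4) : MvPolynomial (Fin 3) k) ∣ X 0) := by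
  intro h
  have h' := (map_dvd_iff (renameEquiv k (Equiv.swap (0 : Fin 3) 2)).toMulEquiv).mpr h
  have h'' := (map_dvd_iff (finSuccEquiv k 2).toMulEquiv).mpr h'
  have h1 : finSuccEquiv k 2 (X 1) = Polynomial.C (X 0) := finSuccEquiv_X_succ (j := 0)
  have h2' : finSuccEquiv k 2 (X 2) = Polynomial.C (X 1) := finSuccEquiv_X_succ (j := 1)
  have hlhs : (finSuccEquiv k 2).toMulEquiv ((renameEquiv k (Equiv.swap (0 : Fin 3) 2)).toMulEquiv
      (X 2 ^ 2 + X 0 ^ 2 * (1 + X 1 ^ 4) : MvPolynomial (Fin 3) k)) =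
      Polynomial.X ^ 2 + Polynomial.C (X 1 ^ 2 * (1 + X 0 ^ 4)) := by
    change finSuccEquiv k 2 (rename (Equiv.swap (0 : Fin 3) 2) _) = _
    simp only [map_add, map_pow, map_mul, map_one, rename_X, Equiv.swap_apply_left, Equiv.swap_apply_right,
      Equiv.swap_apply_of_ne_of_ne (show (1 : Fin 3) ≠ 0 by decide) (show (1 : Fin 3) ≠ 2 by decide),
      finSuccEquiv_X_zero, h1, h2']
  have hrhs : (finSuccEquiv k 2).toMulEquiv ((renameEquiv k (Equiv.swap (0 : Fin 3) 2)).toMulEquiv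
      (X 0 : MvPolynomial (Fin 3) k)) = Polynomial.C (X 1) := by
    change finSuccEquiv k 2 (rename (Equiv.swap (0 : Fin 3) 2) _) = _
    simp only [rename_X, Equiv.swap_apply_left, h2']
  rw [hlhs, hrhs] at h''
  have hne : (Polynomial.C (X 1 : MvPolynomial (Fin 2) k)) ≠ 0 := by
    rw [Ne, Polynomial.C_eq_zero]; exact X_ne_zero 1
  have hdeg := Polynomial.natDegree_le_of_dvd h'' hne
  rw [Polynomial.natDegree_X_pow_add_C, Polynomial.natDegree_C] at hdeg
  omega

/-- **(C2), `x`-chart**: the strict-transform factor `f′₀ = (z/x)² + (x/1)²(1 + (y/x)⁴)` is PRIME in `k[x,y,z][𝔪/x]`.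
[OURS · (TC) input] [cite: StacksProject, Tag 0804] -/
theorem prime_strict_chart₀ [IsAlgClosed k] (h2 : (2 : k) ≠ 0) :
    Prime (PointBlowup.frac 2 k 0 2 ^ 2 + PointBlowup.exc 2 k 0 ^ 2 * (1 + PointBlowup.frac 2 k 0 1 ^ 4)) := by
  obtain ⟨θ, hθ0, hθj⟩ := SpecimenQuartic.exists_ringEquiv_pointChart k 0
  have hθ : θ (X 2 ^ 2 + X 0 ^ 2 * (1 + X 1 ^ 4)) =
      PointBlowup.frac 2 k 0 2 ^ 2 + PointBlowup.exc 2 k 0 ^ 2 * (1 + PointBlowup.frac 2 k 0 1 ^ 4) := by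
    rw [map_add, map_pow, hθj 2 (by decide), map_mul, map_pow, hθ0, map_add, map_one, map_pow, hθj 1 (by decide)]
  rw [← hθ]
  exact (MulEquiv.prime_iff θ.toMulEquiv).mpr (prime_model₀ k h2)

/-- `f′₀ ∤ x/1`. [folklore] -/
theorem not_strict_dvd_exc_chart₀ :
    ¬ (PointBlowup.frac 2 k 0 2 ^ 2 + PointBlowup.exc 2 k 0 ^ 2 * (1 + PointBlowup.frac 2 k 0 1 ^ 4)) ∣ PointBlowup.exc 2 k 0 := by
  obtain ⟨θ, hθ0, hθj⟩ := SpecimenQuartic.exists_ringEquiv_pointChart k 0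
  have hθ : θ (X 2 ^ 2 + X 0 ^ 2 * (1 + X 1 ^ 4)) =
      PointBlowup.frac 2 k 0 2 ^ 2 + PointBlowup.exc 2 k 0 ^ 2 * (1 + PointBlowup.frac 2 k 0 1 ^ 4) := by
    rw [map_add, map_pow, hθj 2 (by decide), map_mul, map_pow, hθ0, map_add, map_one, map_pow, hθj 1 (by decide)]
  rw [← hθ, ← hθ0]
  intro h
  exact not_model₀_dvd_X_zero k ((map_dvd_iff θ.toMulEquiv).mp h)

/-- **(C2), `y`-chart**: the strict-transform factor `f′₁ = (z/y)² + (y/1)²((x/y)⁴ + 1)` is PRIME. [OURS · (TC) input] [cite: StacksProject, Tag 0804] -/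
theorem prime_strict_chart₁ [IsAlgClosed k] (h2 : (2 : k) ≠ 0) :
    Prime (PointBlowup.frac 2 k 1 2 ^ 2 + PointBlowup.exc 2 k 1 ^ 2 * (PointBlowup.frac 2 k 1 0 ^ 4 + 1)) := by
  obtain ⟨θ, hθ1, hθj⟩ := SpecimenQuartic.exists_ringEquiv_pointChart k 1
  have hθ : θ (X 2 ^ 2 + X 1 ^ 2 * (X 0 ^ 4 + 1)) =
      PointBlowup.frac 2 k 1 2 ^ 2 + PointBlowup.exc 2 k 1 ^ 2 * (PointBlowup.frac 2 k 1 0 ^ 4 + 1) := by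
    rw [map_add, map_pow, hθj 2 (by decide), map_mul, map_pow, hθ1, map_add, map_one, map_pow, hθj 0 (by decide)]
  rw [← hθ]
  exact (MulEquiv.prime_iff θ.toMulEquiv).mpr (prime_model₁ k h2)

/-- `f′₁ ∤ y/1`. [folklore] -/
theorem not_strict_dvd_exc_chart₁ :
    ¬ (PointBlowup.frac 2 k 1 2 ^ 2 + PointBlowup.exc 2 k 1 ^ 2 * (PointBlowup.frac 2 k 1 0 ^ 4 + 1)) ∣ PointBlowup.exc 2 k 1 := by
  obtain ⟨θ, hθ1, hθj⟩ := SpecimenQuartic.exists_ringEquiv_pointChart k 1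
  have hθ : θ (X 2 ^ 2 + X 1 ^ 2 * (X 0 ^ 4 + 1)) =
      PointBlowup.frac 2 k 1 2 ^ 2 + PointBlowup.exc 2 k 1 ^ 2 * (PointBlowup.frac 2 k 1 0 ^ 4 + 1) := by
    rw [map_add, map_pow, hθj 2 (by decide), map_mul, map_pow, hθ1, map_add, map_one, map_pow, hθj 0 (by decide)]
  rw [← hθ, ← hθ1]
  intro h
  have h' : (X 2 ^ 2 + X 1 ^ 2 * (X 0 ^ 4 + 1) : MvPolynomial (Fin 3) k) ∣ X 1 := (map_dvd_iff θ.toMulEquiv).mp h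
  -- move to the `x`-chart model by `T₀ ↔ T₁`
  have h'' := (map_dvd_iff (renameEquiv k (Equiv.swap (0 : Fin 3) 1)).toMulEquiv).mpr h'
  have hl : (renameEquiv k (Equiv.swap (0 : Fin 3) 1)).toMulEquiv (X 2 ^ 2 + X 1 ^ 2 * (X 0 ^ 4 + 1) : MvPolynomial (Fin 3) k) =
      X 2 ^ 2 + X 0 ^ 2 * (1 + X 1 ^ 4) := by
    change rename (Equiv.swap (0 : Fin 3) 1) _ = _
    simp only [map_add, map_pow, map_mul, map_one, rename_X, Equiv.swap_apply_left, Equiv.swap_apply_right,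
      Equiv.swap_apply_of_ne_of_ne (show (2 : Fin 3) ≠ 0 by decide) (show (2 : Fin 3) ≠ 1 by decide)]
    ring
  have hr : (renameEquiv k (Equiv.swap (0 : Fin 3) 1)).toMulEquiv (X 1 : MvPolynomial (Fin 3) k) = X 0 := by
    change rename (Equiv.swap (0 : Fin 3) 1) _ = _
    simp only [rename_X, Equiv.swap_apply_right]
  rw [hl, hr] at h''
  exact not_model₀_dvd_X_zero k h''

/-! ## (C3) The reduced exceptional trace `(Xᵢ/1, z/Xᵢ)` and its regular quotient -/

/-- Transport of a radical identity `√(a, b) = J` along a ring isomorphism. [folklore] -/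
theorem radical_span_pair_of_ringEquiv {A B : Type} [CommRing A] [CommRing B] (θ : A ≃+* B) (a b : A) (J : Ideal A)
    (h : (Ideal.span {a, b}).radical = J) : (Ideal.span {θ a, θ b}).radical = J.map θ.toRingHom := by
  have h1 : Ideal.span {θ a, θ b} = (Ideal.span {a, b}).map θ.toRingHom := by
    rw [Ideal.map_span, Set.image_pair]; rfl
  rw [h1, ← Ideal.map_radical_of_surjective θ.surjective (by
    rw [(RingHom.injective_iff_ker_eq_bot θ.toRingHom).mp θ.injective]; exact bot_le), h]

/-- Transport of a pair-generated ideal along a ring isomorphism. [folklore] -/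
theorem map_span_pair_of_ringEquiv {A B : Type} [CommRing A] [CommRing B] (θ : A ≃+* B) (a b : A) :
    (Ideal.span {a, b}).map θ.toRingHom = Ideal.span {θ a, θ b} := by
  rw [Ideal.map_span, Set.image_pair]; rfl

/-- `√(T₀, h₀) = (T₀, T₂)` in `k[T]` (stub-4's `radical_span_X_one_g` after `T₀ ↔ T₁`). [folklore] -/
theorem radical_span_X_zero_model₀ :
    (Ideal.span {(X 0 : MvPolynomial (Fin 3) k), X 2 ^ 2 + X 0 ^ 2 * (1 + X 1 ^ 4)}).radical =
      Ideal.span {(X 0 : MvPolynomial (Fin 3) k), X 2} := by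
  set σ := (renameEquiv k (Equiv.swap (0 : Fin 3) 1)).toRingEquiv with hσ
  have hσ0 : σ (X 0) = X 1 := by simp [hσ, Equiv.swap_apply_left]
  have hσ1 : σ (X 1) = X 0 := by simp [hσ, Equiv.swap_apply_right]
  have hσ2 : σ (X 2) = X 2 := by
    simp [hσ, Equiv.swap_apply_of_ne_of_ne (show (2 : Fin 3) ≠ 0 by decide) (show (2 : Fin 3) ≠ 1 by decide)]
  have hσg : σ (X 2 ^ 2 + X 1 ^ 2 * (1 + X 0 ^ 4)) = X 2 ^ 2 + X 0 ^ 2 * (1 + X 1 ^ 4) := by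
    rw [map_add, map_pow, hσ2, map_mul, map_pow, hσ1, map_add, map_one, map_pow, hσ0]
  have h := radical_span_pair_of_ringEquiv σ (X 1) (X 2 ^ 2 + X 1 ^ 2 * (1 + X 0 ^ 4)) _
    ((SpecimenQuartic.radical_span_X_one_g k).trans (SpecimenQuartic.span_range_cen_eq_pair k))
  rw [hσ1, hσg, map_span_pair_of_ringEquiv, hσ1, hσ2] at h
  exact h

/-- `√(T₁, h₁) = (T₁, T₂)` in `k[T]` (`h₁` is stub-4's `g` verbatim up to `add_comm`). [folklore] -/
theorem radical_span_X_one_model₁ :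
    (Ideal.span {(X 1 : MvPolynomial (Fin 3) k), X 2 ^ 2 + X 1 ^ 2 * (X 0 ^ 4 + 1)}).radical =
      Ideal.span {(X 1 : MvPolynomial (Fin 3) k), X 2} := by
  have h : (X 2 ^ 2 + X 1 ^ 2 * (X 0 ^ 4 + 1) : MvPolynomial (Fin 3) k) = X 2 ^ 2 + X 1 ^ 2 * (1 + X 0 ^ 4) := by ring
  rw [h, SpecimenQuartic.radical_span_X_one_g, SpecimenQuartic.span_range_cen_eq_pair]

/-- `k[T]/(T₁, T₂)` is regular. [folklore] -/
theorem isRegularRing_quotient_span_X_one_X_two :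
    IsRegularRing (MvPolynomial (Fin 3) k ⧸ Ideal.span {(X 1 : MvPolynomial (Fin 3) k), X 2}) := by
  rw [← SpecimenQuartic.span_range_cen_eq_pair]
  exact WhitneyCubic.isRegularRing_quotient_cen k

/-- `k[T]/(T₀, T₂)` is regular (`T₀ ↔ T₁`). [folklore] -/
theorem isRegularRing_quotient_span_X_zero_X_two :
    IsRegularRing (MvPolynomial (Fin 3) k ⧸ Ideal.span {(X 0 : MvPolynomial (Fin 3) k), X 2}) := by
  set σ := (renameEquiv k (Equiv.swap (0 : Fin 3) 1)).toRingEquiv with hσ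
  have hσ1 : σ (X 1) = X 0 := by simp [hσ, Equiv.swap_apply_right]
  have hσ2 : σ (X 2) = X 2 := by
    simp [hσ, Equiv.swap_apply_of_ne_of_ne (show (2 : Fin 3) ≠ 0 by decide) (show (2 : Fin 3) ≠ 1 by decide)]
  haveI := isRegularRing_quotient_span_X_one_X_two k
  have hmap : (Ideal.span {(X 1 : MvPolynomial (Fin 3) k), X 2}).map σ.toRingHom = Ideal.span {(X 0 : MvPolynomial (Fin 3) k), X 2} := by
    rw [map_span_pair_of_ringEquiv, hσ1, hσ2]
  exact IsRegularRing.of_ringEquiv (Ideal.quotientEquiv _ _ σ hmap.symm)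

/-- **(C3), `x`-chart**: `√(x/1, f′₀) = (x/1, z/x)`. [OURS · (TC) input] [cite: StacksProject, Tag 0804] -/
theorem radical_span_exc_strict_chart₀ :
    (Ideal.span {PointBlowup.exc 2 k 0,
        PointBlowup.frac 2 k 0 2 ^ 2 + PointBlowup.exc 2 k 0 ^ 2 * (1 + PointBlowup.frac 2 k 0 1 ^ 4)}).radical =
      Ideal.span {PointBlowup.exc 2 k 0, PointBlowup.frac 2 k 0 2} := by
  obtain ⟨θ, hθ0, hθj⟩ := SpecimenQuartic.exists_ringEquiv_pointChart k 0
  have hθ : θ (X 2 ^ 2 + X 0 ^ 2 * (1 + X 1 ^ 4)) =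
      PointBlowup.frac 2 k 0 2 ^ 2 + PointBlowup.exc 2 k 0 ^ 2 * (1 + PointBlowup.frac 2 k 0 1 ^ 4) := by
    rw [map_add, map_pow, hθj 2 (by decide), map_mul, map_pow, hθ0, map_add, map_one, map_pow, hθj 1 (by decide)]
  have h := radical_span_pair_of_ringEquiv θ (X 0) (X 2 ^ 2 + X 0 ^ 2 * (1 + X 1 ^ 4)) _ (radical_span_X_zero_model₀ k)
  rw [hθ0, hθ, map_span_pair_of_ringEquiv, hθ0, hθj 2 (by decide)] at h
  exact h

/-- **(C3), `x`-chart**: `k[x,y,z][𝔪/x]/(x/1, z/x) ≅ k[y/x]` is REGULAR. [OURS · (TC) input] [cite: StacksProject, Tag 0804] -/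
theorem isRegularRing_quotient_exc_frac_chart₀ :
    IsRegularRing (PointBlowup.Chart 2 k 0 ⧸ Ideal.span {PointBlowup.exc 2 k 0, PointBlowup.frac 2 k 0 2}) := by
  obtain ⟨θ, hθ0, hθj⟩ := SpecimenQuartic.exists_ringEquiv_pointChart k 0
  haveI := isRegularRing_quotient_span_X_zero_X_two k
  have hmap : (Ideal.span {(X 0 : MvPolynomial (Fin 3) k), X 2}).map θ.toRingHom =
      Ideal.span {PointBlowup.exc 2 k 0, PointBlowup.frac 2 k 0 2} := by
    rw [map_span_pair_of_ringEquiv, hθ0, hθj 2 (by decide)]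
  exact IsRegularRing.of_ringEquiv (Ideal.quotientEquiv _ _ θ hmap.symm)

/-- **(C3), `y`-chart**: `√(y/1, f′₁) = (y/1, z/y)`. [OURS · (TC) input] [cite: StacksProject, Tag 0804] -/
theorem radical_span_exc_strict_chart₁ :
    (Ideal.span {PointBlowup.exc 2 k 1,
        PointBlowup.frac 2 k 1 2 ^ 2 + PointBlowup.exc 2 k 1 ^ 2 * (PointBlowup.frac 2 k 1 0 ^ 4 + 1)}).radical =
      Ideal.span {PointBlowup.exc 2 k 1, PointBlowup.frac 2 k 1 2} := by
  obtain ⟨θ, hθ1, hθj⟩ := SpecimenQuartic.exists_ringEquiv_pointChart k 1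
  have hθ : θ (X 2 ^ 2 + X 1 ^ 2 * (X 0 ^ 4 + 1)) =
      PointBlowup.frac 2 k 1 2 ^ 2 + PointBlowup.exc 2 k 1 ^ 2 * (PointBlowup.frac 2 k 1 0 ^ 4 + 1) := by
    rw [map_add, map_pow, hθj 2 (by decide), map_mul, map_pow, hθ1, map_add, map_one, map_pow, hθj 0 (by decide)]
  have h := radical_span_pair_of_ringEquiv θ (X 1) (X 2 ^ 2 + X 1 ^ 2 * (X 0 ^ 4 + 1)) _ (radical_span_X_one_model₁ k)
  rw [hθ1, hθ, map_span_pair_of_ringEquiv, hθ1, hθj 2 (by decide)] at h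
  exact h

/-- **(C3), `y`-chart**: `k[x,y,z][𝔪/y]/(y/1, z/y) ≅ k[x/y]` is REGULAR. [OURS · (TC) input] [cite: StacksProject, Tag 0804] -/
theorem isRegularRing_quotient_exc_frac_chart₁ :
    IsRegularRing (PointBlowup.Chart 2 k 1 ⧸ Ideal.span {PointBlowup.exc 2 k 1, PointBlowup.frac 2 k 1 2}) := by
  obtain ⟨θ, hθ1, hθj⟩ := SpecimenQuartic.exists_ringEquiv_pointChart k 1
  haveI := isRegularRing_quotient_span_X_one_X_two k
  have hmap : (Ideal.span {(X 1 : MvPolynomial (Fin 3) k), X 2}).map θ.toRingHom =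
      Ideal.span {PointBlowup.exc 2 k 1, PointBlowup.frac 2 k 1 2} := by
    rw [map_span_pair_of_ringEquiv, hθ1, hθj 2 (by decide)]
  exact IsRegularRing.of_ringEquiv (Ideal.quotientEquiv _ _ θ hmap.symm)

end SpecimenQuarticTcDelta

end Summit.ResolutionOfSingularities.ResolutionOfSingularities.Cruxes.EquisingularLiftNat.Sections
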